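import Literature.NumberTheory.EllipticCurves.CastellaGrossiSkinner2025.MazurMainConjecture
import Literature.NumberTheory.EllipticCurves.HeegnerPoints
import Literature.NumberTheory.EllipticCurves.Selmer
import HarnessLib

/-!
# Castella–Grossi–Skinner 2025, §5 "Interlude: the rank one case" — Theorem A under the two
# additional hypotheses (a) `corank_{ℤ_p} Sel_{p^∞}(E/K) = 1`, (b) `loc_v ≠ 0`

HONEST FRAMING (cell `bsd-litref`, paper sub-dir `cgs25`, run/shared/lean/pub/bsd-litref/cgs25/;
programme BSD-LIT2PART v1 §T2 and §HONESTY: no tranche of the programme proves BSD; the cell moves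
LITERAL census rows to kernel-proved-modulo-NAMED-print and referees preprint inputs in cell; typed ≠
proved ≠ endorsed). This file vendors ONE published statement as a named fact (`def … : Prop`,
nothing asserted; D-0014) and PROVES that it follows from the sibling fact
`CastellaGrossiSkinner2025.thmA_charIdeal_eq_padicLFunction` (Theorem A in full, file
`MazurMainConjecture.lean`, registry A142) — so it is a DERIVED node, not independent trust debt —
together with its rank-`0` bookkeeping consumer. Seat `bsd-litref-cgs25-ty` (typer), 2026-08-26.

## What and why

The LITERAL census row D4 (`PARTITION-SCOREBOARD.md`: covered row C6, good · odd `p` · reducible ·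
non-anomalous, analytic rank `≤ 1`; flag `CGS25-BST-Thm311`) rests on Castella–Grossi–Skinner 2025
Theorems A / D, whose printed proofs consume ONE unrefereed input: printed Thm. 4.1.1 (Beilinson–Flach
classes `BF_α`, Coleman maps, two explicit reciprocity laws), "proved in [BSTW23, §5]" =
Burungale–Skinner–Tian–Wan, *Zeta elements for elliptic curves and applications*, arXiv:2409.01350
§5 (preprint). The GENERAL proof of Theorem A (§7) uses Thm. 4.1.1 for a family of anticyclotomic
twists `α ≡ 1 (mod ϖ^m)` together with the Beilinson–Flach Euler-system divisibility Thm. 4.3.1 and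
the `α`-twisted Kolyvagin-system bounds of §6. For curves of analytic rank `≤ 1`, however — ALL of
row D4 — the paper prints a SHORT, SELF-CONTAINED proof of Theorem A in §5 ("Interlude: The rank one
case and the general strategy", final TeX l. 2074–2150: "In this section we give a proof of
Theorem A under the following two additional hypotheses: (a) `corank_{ℤ_p} Sel_{p^∞}(E/K) = 1`.
(b) The restriction map `Sel_{p^∞}(E/K) → E(K_v) ⊗ ℚ_p/ℤ_p` is nonzero. … The short argument that
follows, albeit independent from the discussion in the later sections, …"), whose ONLY use of the
preprint node is Prop. 4.2.1 "with `α = 1`" (twice, Steps 2 and 3) ⇐ Cor. 4.1.3 ⇐ Thm. 4.1.1 AT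
THE TRIVIAL TWIST `α = 𝟙` — no Thm. 4.3.1, no §6 (finding F1 of the typing layer, seat
`bsd-littype-02`, `pub/bsd-littype/OPEN-QUESTIONS-02.md`; relayed to the cgs25 seats by the cell lead,
`pub/bsd-litref/cgs25/INBOX.md` 2026-08-26T16:33:21Z). This file gives that printed special case a
NAME, so that (i) the in-cell referee verdict on "[BSTW §5] ⇒ CGS Thm. 4.1.1 at `α = 𝟙`" (readers
`bsd-litref-bstw24-r1`, `-r2`) and the D4 D-audit sheets (`bsd-litref-cgs25-r1`, `-r2`) can be priced by
referee A against a binder BY NAME whose printed proof is exactly the Interlude, and (ii) the prover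
(`bsd-litref-cgs25-pv`) can re-route the D4 consumers to it: for a D4 pair `(E, p)` and the standard
auxiliary `K` (imaginary quadratic with (Heeg), (spl), (disc) and `ord_{s=1} L(E/K, s) = 1`),
hypotheses (a) and (b) hold by Gross–Zagier–Kolyvagin over `K` (rank `E(K) = 1`, `Ш(E/K)` finite,
the Heegner point of infinite order).

## Citation header (read by this seat on the final arXiv TeX `Mazur-paper_revised.tex` = arXiv:2303.04373v2 = Math. Ann. 393 (2025), copy `run/shared/lean/pub/bsd-eis/audit-1-g4/cgs-arxiv-v2-final.tex`, and on the store's LaTeXML text `paper:arxiv-2303.04373` = arXiv v1, where the same section is §4)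

* Authors: Francesc Castella, Giada Grossi, Christopher Skinner.
* Title: *Mazur's main conjecture at Eisenstein primes*.
* Venue: Math. Ann. **393** (2025) 2451–2506, doi:10.1007/s00208-025-03239-x = arXiv:2303.04373v2
  (bib key `CastellaGrossiSkinner2025`). REFEREED / PUBLISHED.
* Statement: **§5 "Interlude: The rank one case and the general strategy"** (TeX `\label{sec:one}`,
  l. 2074–2150; arXiv v1 / LaTeXML: §4, `[corpus: paper:arxiv-2303.04373 p0019 L1–L75]`), opening
  sentence and Steps 1–3, verbatim (TeX l. 2076–2086, 2091, 2148–2149):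

> In this section we give a proof of Theorem A under the following two additional hypotheses:
> (a) `corank_{ℤ_p} Sel_{p^∞}(E/K) = 1`.
> (b) The restriction map `Sel_{p^∞}(E/K) →^{loc_v} E(K_v) ⊗ ℚ_p/ℤ_p` is nonzero.
> The short argument that follows, albeit independent from the discussion in the later sections,
> will allow us to motivate the more involved arguments needed for the proof of Theorem A in
> general … [Steps 1–3] … By Proposition 2.2.4 and Proposition 3.3.1, this equality of
> characteristic ideals together with Kato's divisibility for `E` yields Theorem A in this case.

  (arXiv v1 wording, `[ibid. p0019 L3, L75]`: "we outline a proof of Mazur's main conjecture, as in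
  Theorem (thm:CYC) … under the following two additional hypotheses" / "yields Theorem (thm:CYC)
  (under the additional hypotheses (a) and (b) above)".)
* Standing hypotheses in force at §5 (word for word): §2 (TeX l. 697–702) "Let `E/ℚ` be an elliptic
  curve of conductor `N`, and let `p ∤ 2N` be a prime of good ordinary reduction for `E`. … Let `K`
  be an imaginary quadratic field of discriminant `D_K < 0` prime to `N`, and assume that (spl)
  `(p) = v v̄` splits in `K`"; §2.3 (l. 897–903) "Assume that (Heeg) every prime `ℓ | N` splits in
  `K` … we also assume that (disc) the discriminant `D_K < 0` is odd and `D_K ≠ −3`"; Theorem A's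
  own hypotheses (l. 382–392): "`p > 2` … of good reduction … `p` is Eisenstein with
  `φ|_{G_p} ≠ 1, ω`" (used in §5 through Lemma 3.4.1 / Prop. 3.4.2 with `α = 1`).
* Printed proof inputs of §5 (TeX l. 2097–2149), for the referee's DAG: [CGLS22, Thm. C]
  (anticyclotomic main conjecture under (Sel), PUB) → (5.1); Lemma 3.4.1 and Prop. 3.4.2
  (`lem:coinv`, `prop:euler-char`) with `α = 1`; Kato [Thm. 17.4] refined by Wüthrich [Thm. 16]
  for `E_•`, `E_•^K` (PUB); Props. 2.2.4 / 3.3.1 (`prop:comp-Lcyc`, `prop:comp-Selcyc`); Rohrlich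
  (PUB); Prop. 2.4.5 (`prop:comp-Lac`) / `prop:factor-L-Gr`; **Prop. 4.2.1 (`prop:equiv`) "with
  `α = 1`" — the ONLY consumer of the preprint node: Cor. 4.1.3 ⇐ Thm. 4.1.1 ("proved in
  [BSTW23, §5]", arXiv:2409.01350 §5, PRE) at the trivial twist**; Skinner–Urban [Lem. 3.2];
  Prop. 3.2.3 (`prop:isog-inv`, isogeny invariance). NOT used: Thm. 4.3.1 (`thm:BF-ES`), §6, §7.2.

## Hypotheses, enumerated (word for word → tree predicate)

1.–3. "`E/ℚ`", "`p > 2` … good reduction … Eisenstein … `φ|_{G_p} ≠ 1, ω`" — `W`, `[W.IsElliptic]`,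
   `[W.IsGloballyMinimal]`, `2 < p`, `Good W p`, `Red W p`, `¬ Anom W p`, EXACTLY as in A142 (the
   tree's proved dictionary `Rank1Residual.not_anom_iff_cgs_of_good`; good ORDINARY is automatic,
   `goodOrd_of_red_of_good`). "conductor `N`" = `W.conductorNorm ℤ`.
4. "`K` imaginary quadratic … (Heeg) … (spl) … (disc)" — `IsImaginaryQuadratic K`,
   `SatisfiesHeegnerHypothesis (W.conductorNorm ℤ) K` (every `ℓ ∣ N` splits; it forces `D_K` prime
   to `N`), `SatisfiesHeegnerHypothesis p K` (`p` splits), `Odd (NumberField.discr K)`,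
   `NumberField.discr K ≠ -3` — the atoms of `CastellaGrossiLeeSkinner2022.display57_rankOne_twist`
   and `…proofThm422_…` (same papers, same conditions).
5. (a) "`corank_{ℤ_p} Sel_{p^∞}(E/K) = 1`" — `(W.baseChange K).selmerCorank p = 1`
   (`Literature/…/Selmer.lean`, the atom used for CGLS22's (Sel) in `proofThm422_…`).
6. (b) "`loc_v : Sel_{p^∞}(E/K) → E(K_v) ⊗ ℚ_p/ℤ_p` is nonzero" — transcribed as the SPECIAL CASE
   "`E(K)` has a point of infinite order" (`∃ P : (W.baseChange K).toAffine.Point, ¬ IsOfFinAddOrder P`),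
   which IMPLIES (b): the Kummer image of `E(K) ⊗ ℚ_p/ℤ_p` lies in `Sel_{p^∞}(E/K)`, and a point of
   infinite order has non-zero image in `E(K_v) ⊗ ℚ_p/ℤ_p` (`E(K_v) ≅ ℤ_p^{[K_v:ℚ_p]} ⊕` finite for
   `v ∣ p`; `P ⊗ p^{-n} ≠ 0` for `n > ord_p` of its free component). A statement with a STRONGER
   hypothesis is WEAKER than print — never stronger. `-- TODO(general form): (b) verbatim needs the
   local restriction map on H¹(K, E[p^∞]) with its Kummer image, not in the tree today.` On row D4
   the special case is what holds anyway (Heegner point of infinite order).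
7. Conclusion — VERBATIM the conclusion of A142 (the GV / CGS transcription of "𝔛_ord(E/ℚ_∞) is
   `Λ_ℚ`-torsion with `ch_{Λ_ℚ}(𝔛_ord(E/ℚ_∞)) = (𝓛_p^{MSD}(E/ℚ))`": for the cyclotomic `ℤ_p`-extension
   `κ`, a topological generator `γ` matching the cyclotomic variable, the newform `f` of level `N_E`,
   the rational `ϖ` with `ϖ · Ω_E = Ω⁺_f`, and every dual datum `D`: `D.IsTorsion ∧ ∃ g,
   D.charIdeal = (g) ∧ ι g = ϖ · L_p(f, α_p)`), so that every consumer of A142 can be fed this fact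
   instead once it holds the `K`-data.

D-0026: TWO new `def … : Prop` in this file — the Interlude node and (added 2026-08-26 by the same seat, g2)
its `p ≥ 5`, `p ∤ h_K` tier, see the next section; BOTH are IMPLIED by the existing fact A142
(`thmA_of_selmerCorankOne_of_thmA`, `thmA_of_notDvdClassNumber_of_thmA`, proved below), hence add no
independent trust debt; the rank-`0` consumers `pPartRankZero_of_thmA_of_selmerCorankOne` and
`pPartRankZero_of_thmA_of_notDvdClassNumber` are proved. No `_holds` is to be expected (Iwasawa
main conjecture). Nothing about BSTW24 §5 is asserted here: the preprint dependence of the PRINTED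
PROOF is a matter of record for the referee (flag `CGS25-BST-Thm311`; component
`CGS25-ThmA-Thm4.1.1@BSTW24-§5(arXiv:2409.01350,preprint;read)`), now narrowed BY NAME to
"Thm. 4.1.1 at `α = 𝟙`" for this node.

## The `p ≥ 5`, `p ∤ h_K` tier (in-cell referee of the preprint node; reader sheets of cell `bsd-litref`)

The two independent D-audit sheets of this paper sub-cell (`pub/bsd-litref/cgs25/sheets/D-AUDIT-cgs25-r1.md`
sha16 cd6b303b333505a2, §0 / §6.2; `D-AUDIT-cgs25-r2.md` sha16 0d093e8f7ab6b874, §0(d) / §4 Q1 / §6 V2)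
referee the preprint input printed Thm. 4.1.1 ⇐ [BSTW23, §5] (= arXiv:2409.01350v2 §4; TeX of record
`pub/bsd-eis/audit-1-g4/bstw-arxiv-2409.01350v2.tex` sha16 5926f035551c636d) IN CELL and split it BY
PRIME and, reader 2, BY AUXILIARY FIELD: at `p = 3` the chain leaves refereed print (KLZ17 §7.2 "p ≥ 5"
[corpus: paper:arxiv-1503.02888-gx17373040 p0059:L5]; BSTW TeX l. 2915 and l. 4918–4922 ⇐ [SV-S–Ohta],
unpublished) — GAP(line), typed Summits-side as the claim-tagged binder
`Summit.BirchSwinnertonDyer.Rank1Residual.RowC6.CastellaGrossiSkinner2025_thmA_atThree_OPEN` (p461118);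
at `p ≥ 5` every external input is refereed print (both readers), reader 2 adding ONE proviso on the
auxiliary field `L` of BSTW §4: the printed proof of BSTW Prop. 4.12 (`Sat-prop2`, TeX l. 3381–3386,
with Prop. 4.10 `Str-prop2` l. 3303) is load-bearing only at the height-one primes
`P = (Φ_{p^r}(1 + T_v))`, `1 ≤ r ≤ h_p(L)` (l. 3216, l. 3240–3241), hence only when `h_p(L) ≥ 1`, and
BSTW print the sufficient condition "If `p ∤ h_L`, then `h_p = 0`" (§4.1, l. 2711–2713). Reader 2's
verdict line V2: "PASS-in-cell for auxiliary fields `L` with `h_p(L) = 0` (e.g. `p ∤ h_L`); GAP(line BSTW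
l. 3385–3386, Prop 4.12) for `h_p(L) ≥ 1`". Because CGS CHOOSE the auxiliary field (§7.2, TeX l. 3288:
"Choose an imaginary quadratic field `K` satisfying hypotheses (Heeg), (spl), and (disc)"; §5 likewise),
the proviso is a side condition on `K`, dischargeable per class by exhibiting the field (reader 2's table
`sheets/r2/d4_auxK.tsv`; the analytic condition `ord_{s=1} L(E/K, s) = 1` giving (a), (b) is engine work).
The typer's object for this verdict: `thmA_charIdeal_eq_padicLFunction_of_selmerCorankOne_of_not_dvd_classNumber`
below = the Interlude node with the two further binders `5 ≤ p`, `¬ p ∣ NumberField.classNumber K`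
(WEAKER than print), PROVED from the Interlude node and from A142, with its rank-`0` consumer; its
register tier is the referees' word (C2 = `pub-bsdpct-r4`, A = `pub-bsdpct-r1`; `pub/pub-bsdpct/REFEREE.md`).

## References
* [CastellaGrossiSkinner2025] F. Castella, G. Grossi, C. Skinner, Math. Ann. 393 (2025) 2451–2506 =
  arXiv:2303.04373v2: §5 (Interlude), TeX l. 2074–2150 (v1: §4); Theorem A (l. 382–392) = Thm. 7.1.1;
  §2 / §2.3 standing hypotheses (spl), (Heeg), (disc); Prop. 4.2.1, Cor. 4.1.3, Thm. 4.1.1 (l. 1682–1702,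
  "proved in [BSTW23, §5]").
* [CastellaGrossiLeeSkinner2022] Invent. Math. 227 (2022), Thm. C (= Thm. 4.2.2) — input of Step 1.
* A. Burungale, C. Skinner, Y. Tian, X. Wan, arXiv:2409.01350 (preprint), §5 — the node behind Thm. 4.1.1.
* Tree: `CastellaGrossiSkinner2025/MazurMainConjecture.lean` (A142, Theorem A; VERSION NOTE v1/v2),
  `GreenbergVatsal2000/IwasawaInvariants.lean` (A14; the binder vocabulary), `Selmer.lean`
  (`selmerCorank`), `HeegnerPoints.lean` (`IsImaginaryQuadratic`, `SatisfiesHeegnerHypothesis`).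
* Cell record: `pub/bsd-litref/cgs25/staging/bsd-litref-cgs25-ty/BINDER-MAP.md`; typing-layer finding F1
  (`pub/bsd-littype/STATUS.md` 2026-08-26T16:30:19Z).
-/

set_option autoImplicit false

noncomputable section

open scoped Classical MatrixGroups ModularForm

open CongruenceSubgroup WeierstrassCurve Literature.NumberTheory.EllipticCurves
  Literature.NumberTheory.EllipticCurves.ModularForms Literature.NumberTheory.EllipticCurves.Rank1Residual

namespace Literature.NumberTheory.EllipticCurves.CastellaGrossiSkinner2025

/-- **Castella–Grossi–Skinner, Math. Ann. 393 (2025) 2451–2506 = arXiv:2303.04373v2, §5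
"Interlude: The rank one case" (TeX l. 2074–2150; arXiv v1 §4): Theorem A in the rank-one case.**
"In this section we give a proof of Theorem A under the following two additional hypotheses:
(a) `corank_{ℤ_p} Sel_{p^∞}(E/K) = 1`. (b) The restriction map
`Sel_{p^∞}(E/K) → E(K_v) ⊗ ℚ_p/ℤ_p` is nonzero", for `E/ℚ` of conductor `N`, `p > 2` a good
Eisenstein prime with `φ|_{G_p} ≠ 1, ω`, and `K` an imaginary quadratic field with (Heeg) every
`ℓ ∣ N` splits, (spl) `p = v v̄` splits, (disc) `D_K` odd and `≠ −3` (§2/§2.3 standing); conclusion =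
Theorem A: "`𝔛_ord(E/ℚ_∞)` is `Λ_ℚ`-torsion with `ch_{Λ_ℚ}(𝔛_ord(E/ℚ_∞)) = (𝓛_p^{MSD}(E/ℚ))`".
Transcription (module docstring items 1–7): `2 < p`, `Good W p`, `Red W p`, `¬ Anom W p`;
`IsImaginaryQuadratic K`, `SatisfiesHeegnerHypothesis N_E K`, `SatisfiesHeegnerHypothesis p K`,
`Odd D_K`, `D_K ≠ -3`; (a) `(W.baseChange K).selmerCorank p = 1`; (b) in the SPECIAL CASE "`E(K)`
has a point of infinite order" (implies the printed (b); weaker-than-print transcription, see item 6);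
then VERBATIM the conclusion of `thmA_charIdeal_eq_padicLFunction` (A142). PUBLISHED; its printed
proof (Steps 1–3) uses the preprint node [BSTW23, §5] ONLY through Prop. 4.2.1 / Cor. 4.1.3 at the
trivial twist `α = 𝟙` of Thm. 4.1.1 (documentation for the referee; nothing about it asserted).
Implied by A142 (`thmA_of_selmerCorankOne_of_thmA`).
[cite: CastellaGrossiSkinner2025, §5 "Interlude: The rank one case" (TeX l. 2074–2150; arXiv v1 §4), Theorem A under hypotheses (a), (b); §2 (spl), §2.3 (Heeg), (disc)] -/
def thmA_charIdeal_eq_padicLFunction_of_selmerCorankOne : Prop :=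
  ∀ (W : WeierstrassCurve ℚ) [W.IsElliptic] [W.IsGloballyMinimal] (p : ℕ) [Fact p.Prime],
    2 < p → Good W p → Red W p → ¬ Anom W p →
    ∀ (K : Type) [Field K] [NumberField K], IsImaginaryQuadratic K →
      SatisfiesHeegnerHypothesis (W.conductorNorm ℤ) K → SatisfiesHeegnerHypothesis p K →
      Odd (NumberField.discr K) → NumberField.discr K ≠ -3 →
      (W.baseChange K).selmerCorank p = 1 →
      (∃ P : (W.baseChange K).toAffine.Point, ¬ IsOfFinAddOrder P) →
    ∀ (κ : ZpExtension ℚ p) (γ : Field.absoluteGaloisGroup ℚ),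
        κ.IsCyclotomic → κ.IsTopGenerator γ → IsCyclotomicVariable p γ →
      ∀ [NeZero (W.conductorNorm ℤ)] (f : CuspForm (Gamma0 (W.conductorNorm ℤ)) 2),
        IsNewformOf W f → ∀ (ϖ : ℚ), (ϖ : ℝ) * W.realPeriodRat = plusPeriod f →
      ∀ (D : W.SelmerDualData κ γ), D.IsTorsion ∧
        ∃ g : IwasawaAlgebra p, D.charIdeal = Ideal.span {g} ∧
          iwasawaToPowerSeries p g =
            PowerSeries.C (ϖ : ℚ_[p]) * padicLFunction f (unitRoot W p : ℚ_[p])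

/-- **The Interlude node is IMPLIED by Theorem A** (A142): the rank-one statement has the same
conclusion and more hypotheses, so every instance of it is an instance of
`thmA_charIdeal_eq_padicLFunction` — the new fact is DERIVED, not independent trust debt (D-0026).
[cite: CastellaGrossiSkinner2025, Theorem A and §5 (Interlude)] -/
theorem thmA_of_selmerCorankOne_of_thmA (hA : thmA_charIdeal_eq_padicLFunction) :
    thmA_charIdeal_eq_padicLFunction_of_selmerCorankOne := by
  intro W _ _ p _ hp hgood hred hna K _ _ _hK _hHN _hHp _hodd _hdisc _hsel _hP κ γ hκ hγ hT _ f hf ϖ hϖ D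
  exact hA W p hp hgood hred hna κ γ hκ hγ hT f hf ϖ hϖ D

/-- **The Interlude node ⇒ the rank-`0` print shape**, for a pair carrying the auxiliary field:
for `W/ℚ` globally minimal elliptic, `p > 2` good with `E[p]` reducible and `a_p ≢ 1 (mod p)`,
`L(E,1) ≠ 0`, and an imaginary quadratic `K` with (Heeg), (spl), (disc), `corank Sel_{p^∞}(E/K) = 1`
and a `K`-point of infinite order, the rank-`0` shape `PPartRankZero W p` follows exactly as in
`pPartRankZero_of_thmA` (Greenberg's Thm. 4.1 inline as `hGr`, modularity `hmod`,
Gross–Zagier–Kolyvagin `hGZK`, the tree glue `padicValRat_bsd_rank_zero_of_mazurMainConjecture`;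
ordinarity from `goodOrd_of_red_of_good`) — "In the case `r = 0`, the argument is the same as in
[CGLS22, Thm. 5.1.4], replacing the appeal to [GV00] by an appeal to our Theorem A", with Theorem A
taken in its §5 form. [cite: CastellaGrossiSkinner2025, Theorem D (r = 0) and its proof (§1.2), from Theorem A in the form of §5 (Interlude)]
[cite: CastellaGrossiLeeSkinner2022, Thm. 5.1.4 (the shape of the deduction)] -/
theorem pPartRankZero_of_thmA_of_selmerCorankOne
    (hA : thmA_charIdeal_eq_padicLFunction_of_selmerCorankOne)
    (hmod : nonempty_modularParametrizationData)
    (hGZK : rank_eq_analyticRank_of_analyticRank_le_one)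
    (W : WeierstrassCurve ℚ) [W.IsElliptic] [W.IsGloballyMinimal] (p : ℕ) [Fact p.Prime]
    (hp : 2 < p) (hgood : Good W p) (hred : Red W p) (hna : ¬ Anom W p)
    (hL : W.entireLFunction 1 ≠ 0)
    (K : Type) [Field K] [NumberField K] (hK : IsImaginaryQuadratic K)
    (hHN : SatisfiesHeegnerHypothesis (W.conductorNorm ℤ) K) (hHp : SatisfiesHeegnerHypothesis p K)
    (hodd : Odd (NumberField.discr K)) (hdisc : NumberField.discr K ≠ -3)
    (hsel : (W.baseChange K).selmerCorank p = 1)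
    (hP : ∃ P : (W.baseChange K).toAffine.Point, ¬ IsOfFinAddOrder P)
    (hGr : ∀ (κ : ZpExtension ℚ p) (γ : Field.absoluteGaloisGroup ℚ),
        κ.IsCyclotomic → κ.IsTopGenerator γ → IsCyclotomicVariable p γ →
      ∀ (D : W.SelmerDualData κ γ) [Module.Finite (IwasawaAlgebra p) D.X], D.IsTorsion →
      ∀ (fE : IwasawaAlgebra p), D.charIdeal = Ideal.span {fE} →
        Finite (W.selmerGroupPInfty p) →
        ∃ u : ℤ_[p]ˣ,
          ((PowerSeries.constantCoeff fE : ℤ_[p]) : ℚ_[p]) *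
              (Nat.card (AddCommGroup.primaryComponent W.toAffine.Point p) : ℚ_[p]) ^ 2 =
            ((u : ℤ_[p]) : ℚ_[p]) * (p : ℚ_[p]) ^ (padicValNat p W.tamagawaProduct) *
              (Nat.card (AddCommGroup.primaryComponent
                ((integralModelInt W).map (Int.castRingHom (ZMod p))).toAffine.Point p) : ℚ_[p]) ^ 2 *
              (Nat.card (W.selmerGroupPInfty p) : ℚ_[p])) :
    PPartRankZero W p := by
  have hord : ¬ (p : ℤ) ∣ W.frobeniusTrace p := (goodOrd_of_red_of_good W p hp hgood hred).2
  have hr : W.analyticRank = 0 :=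
    Literature.NumberTheory.EllipticCurves.analyticRank_eq_zero_of_entireLFunction_one_ne_zero W hL
  obtain ⟨-, hfin⟩ := hGZK W (by omega)
  exact padicValRat_bsd_rank_zero_of_mazurMainConjecture W p hgood hord hL hfin hmod hGr
    (fun κ γ hκ hγ hT _ f hf ϖ hϖ D ↦
      hA W p hp hgood hred hna K hK hHN hHp hodd hdisc hsel hP κ γ hκ hγ hT f hf ϖ hϖ D)

/-- **Hypotheses (a) and (b) from the Gross–Zagier–Kolyvagin shape over `K`.** If `rank_ℤ E(K) = 1`
and `Ш(E/K)[p^∞]` is finite (for a D4 pair and the standard auxiliary `K` with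
`ord_{s=1} L(E/K, s) = 1`: Gross–Zagier + Kolyvagin), then (a) `corank_{ℤ_p} Sel_{p^∞}(E/K) = 1` —
by the corank identity `corank Sel_{p^∞} = rank + corank Ш[p^∞]` (Greenberg 1999 §1; the tree's
named fact `WeierstrassCurve.selmerCorank_eq_mordellWeilRank_add`, taken as the hypothesis `hcork`)
— and the special case of (b) used by `thmA_charIdeal_eq_padicLFunction_of_selmerCorankOne`:
`E(K)` has a point of infinite order (`finrank_ℤ E(K) = 1 ⇒ rank ≠ 0 ⇒` Mathlib
`rank_eq_zero_iff`). Consumer convenience for the D4 re-route; no new fact.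
[cite: Greenberg1999, §1 (p. 53), corank identity] [cite: CastellaGrossiSkinner2025, §5 (Interlude), hypotheses (a), (b)] -/
theorem selmerCorank_eq_one_and_exists_not_isOfFinAddOrder
    {K : Type} [Field K] [NumberField K] (W : WeierstrassCurve ℚ) [W.IsElliptic]
    (p : ℕ) [Fact p.Prime]
    (hcork : (W.baseChange K).selmerCorank_eq_mordellWeilRank_add)
    (hrank : (W.baseChange K).mordellWeilRank = 1)
    (hfin : Finite (AddCommGroup.primaryComponent (W.baseChange K).sha p)) :
    (W.baseChange K).selmerCorank p = 1 ∧
      ∃ P : (W.baseChange K).toAffine.Point, ¬ IsOfFinAddOrder P := by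
  refine ⟨?_, ?_⟩
  · rw [hcork p, hrank, WeierstrassCurve.shaCorank, zpCorank_of_finite_eq_zero]
  · have hr : Module.rank ℤ (W.baseChange K).toAffine.Point ≠ 0 := by
      intro h0
      have h1 : (W.baseChange K).mordellWeilRank = 0 := Module.finrank_eq_zero_of_rank_eq_zero h0
      omega
    rw [Ne, rank_eq_zero_iff] at hr
    push Not at hr
    obtain ⟨P, hP⟩ := hr
    refine ⟨P, fun hP' => ?_⟩
    obtain ⟨n, hn, hnP⟩ := isOfFinAddOrder_iff_zsmul_eq_zero.1 hP'
    exact hP n hn hnP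

/-! ### The `p ≥ 5`, `p ∤ h_K` tier of the Interlude node (module docstring §"The `p ≥ 5`, `p ∤ h_K` tier") -/

/-- **Castella–Grossi–Skinner, Math. Ann. 393 (2025), §5 "Interlude: The rank one case" — Theorem A in
the rank-one case, for `p ≥ 5` and an auxiliary field `K` with `p ∤ h_K`.** The statement of
`thmA_charIdeal_eq_padicLFunction_of_selmerCorankOne` (TeX l. 2074–2150: Theorem A under
(a) `corank_{ℤ_p} Sel_{p^∞}(E/K) = 1`, (b) in the special case "`E(K)` has a point of infinite order",
`K` imaginary quadratic with (Heeg) every `ℓ ∣ N` splits, (spl) `p` splits, (disc) `D_K` odd and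
`≠ −3`) with TWO further binders, the two conditions under which the cell's readers report every
external input of the printed proof's preprint node (printed Thm. 4.1.1 ⇐ [BSTW23, §5] =
arXiv:2409.01350v2 §4) as refereed print: `5 ≤ p` (Kings–Loeffler–Zerbes 2017 §7.2 "We assume, for the
remainder of this paper, that `p ≥ 5`" [corpus: paper:arxiv-1503.02888-gx17373040 p0059:L5]; BSTW TeX
l. 2915 "For `p ≥ 5`, this theorem is explained in [FK, §§1.7–1.8] …") and `¬ p ∣ h_K` (BSTW §4.1, TeX
l. 2711–2713: "Let `h_p ≥ 0` be the integer such that `Γ̄_L^w = (Γ_L^w)^{p^{h_p}}`. If `p ∤ h_L`, then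
`h_p = 0`" — the printed sufficient condition under which the height-one primes `P = (Φ_{p^r}(1+T_v))`,
`1 ≤ r ≤ h_p` (l. 3216, 3240–3241) are absent and printed Props. 4.10 / 4.12 (l. 3303 / 3381–3386) are
not on the proof path; reader sheet `D-AUDIT-cgs25-r2.md` 0d093e8f7ab6b874 §4 Q1 / §6 V2). CGS choose
the auxiliary field freely (§7.2, TeX l. 3288 "Choose an imaginary quadratic field `K` satisfying
hypotheses (Heeg), (spl), and (disc)"), so this is Theorem A AS PRINTED read on a sub-family of its own
auxiliary data: WEAKER than print (more hypotheses), never stronger; implied by the Interlude node and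
by A142 (`thmA_of_notDvdClassNumber_of_thmA_of_selmerCorankOne`, `thmA_of_notDvdClassNumber_of_thmA`)
— a DERIVED node, no independent trust debt (D-0026). Nothing about [BSTW23, §5] is asserted here; the
register tier of this binder is the referees' word, recorded in the cell. `h_K` = Mathlib
`NumberField.classNumber K`, the tree's spelling of "`p ∤ h_K`" (as in
`HowardHypotheses.not_dvd_classNumber`, `BeckwithRaumRichter2024.thm1_exists_imaginaryQuadratic_split_not_dvd_classNumber`);
for imaginary quadratic `K` it is the reduced-forms count `h(d_K)`
(`ClassGroup.card_reducedForms_eq_classNumber`, `QuadraticFields/DedekindZetaReducedForms.lean`).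
Conclusion VERBATIM that of `thmA_charIdeal_eq_padicLFunction` (A142).
[cite: CastellaGrossiSkinner2025, §5 "Interlude: The rank one case" (TeX l. 2074–2150), Theorem A under hypotheses (a), (b); §2 (spl), §2.3 (Heeg), (disc); §7.2 TeX l. 3288 (free choice of K); Thm. 4.1.1 l. 1682–1702 ("proved in [BSTW23, §5]") — the extra binders `5 ≤ p`, `p ∤ h_K` transcribe arXiv:2409.01350v2 TeX l. 2915 and l. 2711–2713] -/
def thmA_charIdeal_eq_padicLFunction_of_selmerCorankOne_of_not_dvd_classNumber : Prop :=
  ∀ (W : WeierstrassCurve ℚ) [W.IsElliptic] [W.IsGloballyMinimal] (p : ℕ) [Fact p.Prime],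
    5 ≤ p → Good W p → Red W p → ¬ Anom W p →
    ∀ (K : Type) [Field K] [NumberField K], IsImaginaryQuadratic K →
      SatisfiesHeegnerHypothesis (W.conductorNorm ℤ) K → SatisfiesHeegnerHypothesis p K →
      Odd (NumberField.discr K) → NumberField.discr K ≠ -3 →
      ¬ p ∣ NumberField.classNumber K →
      (W.baseChange K).selmerCorank p = 1 →
      (∃ P : (W.baseChange K).toAffine.Point, ¬ IsOfFinAddOrder P) →
    ∀ (κ : ZpExtension ℚ p) (γ : Field.absoluteGaloisGroup ℚ),
        κ.IsCyclotomic → κ.IsTopGenerator γ → IsCyclotomicVariable p γ →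
      ∀ [NeZero (W.conductorNorm ℤ)] (f : CuspForm (Gamma0 (W.conductorNorm ℤ)) 2),
        IsNewformOf W f → ∀ (ϖ : ℚ), (ϖ : ℝ) * W.realPeriodRat = plusPeriod f →
      ∀ (D : W.SelmerDualData κ γ), D.IsTorsion ∧
        ∃ g : IwasawaAlgebra p, D.charIdeal = Ideal.span {g} ∧
          iwasawaToPowerSeries p g =
            PowerSeries.C (ϖ : ℚ_[p]) * padicLFunction f (unitRoot W p : ℚ_[p])

/-- **The `p ≥ 5`, `p ∤ h_K` tier is IMPLIED by the Interlude node**: same conclusion, two more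
hypotheses (`5 ≤ p` gives `2 < p`; `¬ p ∣ h_K` is simply not used), so every instance of it is an
instance of `thmA_charIdeal_eq_padicLFunction_of_selmerCorankOne` — DERIVED, no new trust debt
(D-0026). [cite: CastellaGrossiSkinner2025, §5 (Interlude), Theorem A under (a), (b)] -/
theorem thmA_of_notDvdClassNumber_of_thmA_of_selmerCorankOne
    (h : thmA_charIdeal_eq_padicLFunction_of_selmerCorankOne) :
    thmA_charIdeal_eq_padicLFunction_of_selmerCorankOne_of_not_dvd_classNumber := by
  intro W _ _ p _ hp hgood hred hna K _ _ hK hHN hHp hodd hdisc _hh hsel hP κ γ hκ hγ hT _ f hf ϖ hϖ D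
  exact h W p (by omega) hgood hred hna K hK hHN hHp hodd hdisc hsel hP κ γ hκ hγ hT f hf ϖ hϖ D

/-- **The `p ≥ 5`, `p ∤ h_K` tier is IMPLIED by Theorem A** (A142), through the Interlude node.
[cite: CastellaGrossiSkinner2025, Theorem A and §5 (Interlude)] -/
theorem thmA_of_notDvdClassNumber_of_thmA (hA : thmA_charIdeal_eq_padicLFunction) :
    thmA_charIdeal_eq_padicLFunction_of_selmerCorankOne_of_not_dvd_classNumber :=
  thmA_of_notDvdClassNumber_of_thmA_of_selmerCorankOne (thmA_of_selmerCorankOne_of_thmA hA)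

/-- **The `p ≥ 5`, `p ∤ h_K` tier ⇒ the rank-`0` print shape**, for a pair carrying an auxiliary field
with `p ∤ h_K`: for `W/ℚ` globally minimal elliptic, `p ≥ 5` good with `E[p]` reducible and
`a_p ≢ 1 (mod p)`, `L(E,1) ≠ 0`, and an imaginary quadratic `K` with (Heeg), (spl), (disc), `p ∤ h_K`,
`corank Sel_{p^∞}(E/K) = 1` and a `K`-point of infinite order, the rank-`0` shape `PPartRankZero W p`
follows exactly as in `pPartRankZero_of_thmA` / `pPartRankZero_of_thmA_of_selmerCorankOne`
(Greenberg's Thm. 4.1 inline as `hGr`, modularity `hmod`, Gross–Zagier–Kolyvagin `hGZK`, the tree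
glue `padicValRat_bsd_rank_zero_of_mazurMainConjecture`; ordinarity from `goodOrd_of_red_of_good`) —
"In the case `r = 0`, the argument is the same as in [CGLS22, Thm. 5.1.4], replacing the appeal to
[GV00] by an appeal to our Theorem A", with Theorem A taken in its §5 form on this sub-family of
auxiliary fields. The binders `K`, `p ∤ h_K` (= `h(d_K)` by `ClassGroup.card_reducedForms_eq_classNumber`),
`L(E,1) ≠ 0` and the rank-one data over `K` (`selmerCorank_eq_one_and_exists_not_isOfFinAddOrder`
from `rank E(K) = 1`, `Ш(E/K)[p^∞]` finite) are the columns a per-class certificate supplies.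
[cite: CastellaGrossiSkinner2025, Theorem D (r = 0) and its proof (§1.2), from Theorem A in the form of §5 (Interlude)]
[cite: CastellaGrossiLeeSkinner2022, Thm. 5.1.4 (the shape of the deduction)] -/
theorem pPartRankZero_of_thmA_of_notDvdClassNumber
    (hA : thmA_charIdeal_eq_padicLFunction_of_selmerCorankOne_of_not_dvd_classNumber)
    (hmod : nonempty_modularParametrizationData)
    (hGZK : rank_eq_analyticRank_of_analyticRank_le_one)
    (W : WeierstrassCurve ℚ) [W.IsElliptic] [W.IsGloballyMinimal] (p : ℕ) [Fact p.Prime]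
    (hp : 5 ≤ p) (hgood : Good W p) (hred : Red W p) (hna : ¬ Anom W p)
    (hL : W.entireLFunction 1 ≠ 0)
    (K : Type) [Field K] [NumberField K] (hK : IsImaginaryQuadratic K)
    (hHN : SatisfiesHeegnerHypothesis (W.conductorNorm ℤ) K) (hHp : SatisfiesHeegnerHypothesis p K)
    (hodd : Odd (NumberField.discr K)) (hdisc : NumberField.discr K ≠ -3)
    (hh : ¬ p ∣ NumberField.classNumber K)
    (hsel : (W.baseChange K).selmerCorank p = 1)
    (hP : ∃ P : (W.baseChange K).toAffine.Point, ¬ IsOfFinAddOrder P)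
    (hGr : ∀ (κ : ZpExtension ℚ p) (γ : Field.absoluteGaloisGroup ℚ),
        κ.IsCyclotomic → κ.IsTopGenerator γ → IsCyclotomicVariable p γ →
      ∀ (D : W.SelmerDualData κ γ) [Module.Finite (IwasawaAlgebra p) D.X], D.IsTorsion →
      ∀ (fE : IwasawaAlgebra p), D.charIdeal = Ideal.span {fE} →
        Finite (W.selmerGroupPInfty p) →
        ∃ u : ℤ_[p]ˣ,
          ((PowerSeries.constantCoeff fE : ℤ_[p]) : ℚ_[p]) *
              (Nat.card (AddCommGroup.primaryComponent W.toAffine.Point p) : ℚ_[p]) ^ 2 =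
            ((u : ℤ_[p]) : ℚ_[p]) * (p : ℚ_[p]) ^ (padicValNat p W.tamagawaProduct) *
              (Nat.card (AddCommGroup.primaryComponent
                ((integralModelInt W).map (Int.castRingHom (ZMod p))).toAffine.Point p) : ℚ_[p]) ^ 2 *
              (Nat.card (W.selmerGroupPInfty p) : ℚ_[p])) :
    PPartRankZero W p := by
  have hp2 : 2 < p := by omega
  have hord : ¬ (p : ℤ) ∣ W.frobeniusTrace p := (goodOrd_of_red_of_good W p hp2 hgood hred).2
  have hr : W.analyticRank = 0 :=
    Literature.NumberTheory.EllipticCurves.analyticRank_eq_zero_of_entireLFunction_one_ne_zero W hL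
  obtain ⟨-, hfin⟩ := hGZK W (by omega)
  exact padicValRat_bsd_rank_zero_of_mazurMainConjecture W p hgood hord hL hfin hmod hGr
    (fun κ γ hκ hγ hT _ f hf ϖ hϖ D ↦
      hA W p hp hgood hred hna K hK hHN hHp hodd hdisc hh hsel hP κ γ hκ hγ hT f hf ϖ hϖ D)

end Literature.NumberTheory.EllipticCurves.CastellaGrossiSkinner2025

end
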